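import Summits.BirchSwinnertonDyer.BirchSwinnertonDyer.Theorems.QuadraticBranchSignedControlPlusEtaNonsurjFineRoadRecordsC
import Summits.BirchSwinnertonDyer.BirchSwinnertonDyer.Theorems.QuadraticBranchSignedControlPlusEtaNonsurjFineRoadRecordsD
import Summits.BirchSwinnertonDyer.BirchSwinnertonDyer.Theorems.QuadraticBranchSignedControlPlusEtaNonsurjFineRoadRecordsE
import Summits.BirchSwinnertonDyer.BirchSwinnertonDyer.Theorems.QuadraticBranchSignedControlPlusEtaNonsurjModFiveCongruenceRecordsA
import HarnessLib

/-!
# Route `QuadraticBranchSignedControl` (rung K8, cell `bsd-potss`), residual crux `PlusEtaMainConjectureNonsurj`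
# (stmt-BirchSwinnertonDyer-19606): the 12 CM-UNIT-SIBLING records of k8eta-c2 g7 (FINE ROAD parts C/D/E) RE-ISSUED with the
# mod-`5` congruence FROM PRINT — Fisher's Hesse families as the landed named facts instead of the displayed `hcong`
# — part A of the re-issue: the 6 rows of the `2700p1` class sibling `[0,0,0,0,−675]` (g7 part C) (seat `bsd-potss-k8eta-c2` g8; `--supports` helper; ROUTE-FREE; nothing booked, BSD is not proved by any of this)

WHAT. Seat g7's records `EtaFineRoadRecords.etaMC_r{0,1}_<W>_5_cmUnitSibling` (p540591 / p540881 / p541151) settle (C1⁺_η)(V,5)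
for every good `a_5 = 0` globally minimal model `V` of the `5`-twist of the 7 TAMAGAWA rank-0 rows (78300bh1, 159300l1, 164700i1,
164700n1, 162675n1, 404325f1, 417600fp1) and 5 PRIME-`L` rank-1 rows (78300bd1, 159300h1, 417600gp1, 341775cf1, 341775dm1) of
crux 19606 through the RANK-0 CM UNIT SIBLINGS `A` of their anchor classes (`[0,0,0,0,−675]`, `[0,0,1,0,−169]`, `[0,0,0,0,800]`,
`[0,0,1,0,−405169]`; statement (A) at `A` = the K9 TREE THEOREM `conjA_rat_of_cmFineUnitData_tamagawa`), with the mod-`5`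
congruence `W[5] ≃ A[5]` DISPLAYED (`hcong`; evidence = two points of Fisher's families read numerically, kit j281329 /
j281670). Seat `bsd-potss-conjA-anchor` g7 typed Fisher's families as NAMED PUBLISHED FACTS (`HesseFamilyFive.thm132_…` /
`thm58_…`, p543671 / p545896) and this seat's `EtaModFiveCongruenceRecords` (part A) proves `ModPCongruent W A 5` for each of the
12 pairs modulo ONE of them by a kernel certificate. THIS FILE re-issues the 12 records with `hcong` DISCHARGED — each a
`refine` of the original with the certificate in the `hcong` slot (ns `EtaFineRoadRecordsFisher`, names `<original>_fisher`).

AFTER THIS FILE each of the 12 rows is settled per row modulo NAMED PUBLISHED FACTS (`hPT hmod hGZK h22 h41 hKO h6273 hS28`,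
resp. `hmod hGZK h22 h41 h6273 hS28` on the rank-1 rows, + ONE Fisher fact `hF`) and DISPLAYED ANALYTIC / FINITE inputs only:
the row's `L(W,1) ≠ 0` and `#Ш(W)_an = 1` (r0) resp. `r_an(W) = 1` and the PARI shape `(L_5⁺(V,η,X)) = (X)` (r1), the analytic
`μ(L_5⁺) = 0` (r0), the sibling's `r_an = 0`, `#Ш_an = 1`, `5 ∤ Tam`, and the local `5`-torsion test at the places of `S`
(`hS hlocp`). No Kraus–Oesterlé / Fisher-point EVIDENCE remains in hypothesis position for the congruence.

HONEST FRAMING (cell `bsd-potss`; HUMAN RULING D-0036/D-0074): BOOKKEEPING THEOREMS ONLY — no definition, no new fact, no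
`sorry`, axioms standard; CONDITIONAL on the named facts in hypothesis position. 19606 stays OPEN (class-wide = Conjecture A
on the additive partners + (E⁺_η)); nothing is booked; BSD(W,5) is claimed for no pair; no label / mark / count moves.
`--supports stmt-BirchSwinnertonDyer-19606`.

References: [Fisher2012Hessian] Thm. 13.2; [Fisher2013TwistsOfX5] Thm. 5.8; [LimSujatha2018] Prop. 3.2; [Kobayashi2003]
§4, Thm. 4.1; [BurungaleFlach2024] Thm. 1.1, Cor. 2; [Cremona1997] Table 1.
-/

set_option autoImplicit false
set_option linter.dupNamespace false

noncomputable section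

open scoped Classical

open CongruenceSubgroup Field Function NumberField IsDedekindDomain WeierstrassCurve
open Literature.NumberTheory.EllipticCurves
open Literature.NumberTheory.EllipticCurves.ModularForms
open Literature.NumberTheory.EllipticCurves.Rank1Residual
open Literature.NumberTheory.GaloisRepresentations
open Literature.NumberTheory.GaloisCohomology
open Literature.NumberTheory.EllipticCurves.GreenbergVatsal2000
open Literature.NumberTheory.EllipticCurves.GreenbergSelmer (decomp)
open Literature.NumberTheory.EllipticCurves.HesseFamilyFive (thm132_geomTorsionFive_of_hesseFamily
  thm58_geomTorsionFive_of_dualHesseFamily)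
open Summit.BirchSwinnertonDyer.Rank1Residual.X11b
open Summit.BirchSwinnertonDyer.Rank1Residual.Additive

namespace Summit.BirchSwinnertonDyer.BirchSwinnertonDyer.Theorems

namespace EtaFineRoadRecordsFisher

set_option maxRecDepth 100000 in
/-- **`etaMC_r0_78300bh1_5_cmUnitSibling_fisher`, the congruence from print** — the record
`EtaFineRoadRecords.etaMC_r0_78300bh1_5_cmUnitSibling` (k8eta-c2 g7) with its displayed mod-`5` congruence `hcong : W[5] ≃ A[5]`
(row `78300bh1` ~ CM unit sibling `A = [0, 0, 0, 0, -675]`) DISCHARGED: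
`hcong := EtaModFiveCongruenceRecords.modPCongruent_78300bh1_A2700 hF …` — the row is the point `(λ:μ) = (-180 : 1)` of the
INDIRECT Hesse family of `A`, rescaled by `v = 1/132239526912000000` (kernel certificate), so the congruence now rests on the
NAMED PUBLISHED FACT `HesseFamilyFive.thm58_geomTorsionFive_of_dualHesseFamily` alone (Fisher). All other binders, the
conclusion and the honest framing are those of the original record VERBATIM (per-row instance; CONDITIONAL on the named facts in
hypothesis position; the anchor's `r_an = 0`, `#Ш_an = 1`, `5 ∤ Tam`, the local test at `5`, and the row's L-data stay
displayed; nothing booked; BSD for no pair). [cite: Fisher2013TwistsOfX5, Thm. 5.8] [cite: LimSujatha2018, §3 Prop. 3.2]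
[cite: Kobayashi2003, §4 (p. 8)] [cite: Cremona1997, Table 1 (label 78300bh1)] -/
theorem etaMC_r0_78300bh1_5_cmUnitSibling_fisher (hF : thm58_geomTorsionFive_of_dualHesseFamily)
    (hPT : poitouTate_selmerStructure_duality_real ℚ) (hmod : hasEntireLFunction_rat)
    (hGZK : rank_eq_analyticRank_of_analyticRank_le_one)
    (h22 : Kobayashi2003.thm22_etaSignedSelmerDual_finite_torsion)
    (h41 : Kobayashi2003.thm41_plusEtaCharIdeal_dvd)
    (hKO : KitajimaOtsuki2018.mainThm13_etaSignedSelmerDual_noFiniteSubmodule)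
    (h6273 : Kobayashi2003.thm62_63_73_etaColemanPoitouTate) (hS28 : bsdTriple_of_hasCM_of_L_one_ne_zero)
    (W : WeierstrassCurve ℚ) (hW : W = ⟨0, 0, 0, (-705375), 135465750⟩) (hLW : W.entireLFunction 1 ≠ 0)
    (hs : shaAn W = ((1 : ℕ) : ℚ))
    (A : WeierstrassCurve ℚ) (hA : A = ⟨0, 0, 0, 0, (-675)⟩)
    (hr : A.analyticRank = 0) (hm : shaAn A = ((1 : ℕ) : ℂ)) (htam : ¬ 5 ∣ A.tamagawaProduct)
    (S : Finset (HeightOneSpectrum (𝓞 ℚ))) (hS : ∀ v ∉ S, (((5 : ℕ) : ℕ) : 𝓞 ℚ) ∉ v.asIdeal ∧ A.HasGoodReductionAt v)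
    (hlocp : ∀ v ∈ S, (((5 : ℕ) : ℕ) : 𝓞 ℚ) ∈ v.asIdeal →
      ∀ x : A.geomPrimaryTorsion 5, 5 • x = 0 → (∀ d ∈ decomp v, d • x = x) → x = 0) :
    ∀ (V : WeierstrassCurve ℚ) [V.IsElliptic] [V.IsGloballyMinimal] [Fact (5 : ℕ).Prime],
      (∃ C : VariableChange ℚ, C • W.quadraticTwist (5) = V) →
      V.HasGoodReductionAtPrime 5 → V.frobeniusTrace 5 = 0 →
      (∀ {N : ℕ} [NeZero N] {f : CuspForm (Gamma0 N) 2}, IsNewformOf V f →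
        ∀ (ϖ : ℚ), (if Even (5 / 2) then (ϖ : ℝ) * V.realPeriodRat = plusPeriod f
            else (ϖ : ℝ) * V.imaginaryPeriodRat = minusPeriod f) →
        ∀ (Lη : IwasawaAlgebra 5), IsQuadraticBranchPlusLFunction f 5 ϖ Lη → HasUnitContent Lη) →
        QuadraticBranchPlusEtaMainConjectureAt V 5 := by
  refine EtaFineRoadRecords.etaMC_r0_78300bh1_5_cmUnitSibling hPT hmod hGZK h22 h41 hKO h6273 hS28 W hW hLW hs A hA ?_ hr hm htam S hS hlocp
  subst hW; subst hA
  haveI := EtaFineRoadRecords.isElliptic_78300bh1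
  haveI := EtaFineRoadRecords.isElliptic_A2700
  exact EtaModFiveCongruenceRecords.modPCongruent_78300bh1_A2700 hF _ _ rfl rfl

set_option maxRecDepth 100000 in
/-- **`etaMC_r0_159300l1_5_cmUnitSibling_fisher`, the congruence from print** — the record
`EtaFineRoadRecords.etaMC_r0_159300l1_5_cmUnitSibling` (k8eta-c2 g7) with its displayed mod-`5` congruence `hcong : W[5] ≃ A[5]`
(row `159300l1` ~ CM unit sibling `A = [0, 0, 0, 0, -675]`) DISCHARGED:
`hcong := EtaModFiveCongruenceRecords.modPCongruent_159300l1_A2700 hF …` — the row is the point `(λ:μ) = (-180 : 1)` of the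
DIRECT Hesse family of `A`, rescaled by `v = 1/340122240000` (kernel certificate), so the congruence now rests on the NAMED
PUBLISHED FACT `HesseFamilyFive.thm132_geomTorsionFive_of_hesseFamily` alone (Fisher). All other binders, the conclusion and the
honest framing are those of the original record VERBATIM (per-row instance; CONDITIONAL on the named facts in hypothesis
position; the anchor's `r_an = 0`, `#Ш_an = 1`, `5 ∤ Tam`, the local test at `5`, and the row's L-data stay displayed; nothing
booked; BSD for no pair). [cite: Fisher2012Hessian, Thm. 13.2 (i)] [cite: LimSujatha2018, §3 Prop. 3.2]
[cite: Kobayashi2003, §4 (p. 8)] [cite: Cremona1997, Table 1 (label 159300l1)] -/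
theorem etaMC_r0_159300l1_5_cmUnitSibling_fisher (hF : thm132_geomTorsionFive_of_hesseFamily)
    (hPT : poitouTate_selmerStructure_duality_real ℚ) (hmod : hasEntireLFunction_rat)
    (hGZK : rank_eq_analyticRank_of_analyticRank_le_one)
    (h22 : Kobayashi2003.thm22_etaSignedSelmerDual_finite_torsion)
    (h41 : Kobayashi2003.thm41_plusEtaCharIdeal_dvd)
    (hKO : KitajimaOtsuki2018.mainThm13_etaSignedSelmerDual_noFiniteSubmodule)
    (h6273 : Kobayashi2003.thm62_63_73_etaColemanPoitouTate) (hS28 : bsdTriple_of_hasCM_of_L_one_ne_zero)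
    (W : WeierstrassCurve ℚ) (hW : W = ⟨0, 0, 0, (-121125), 12756625⟩) (hLW : W.entireLFunction 1 ≠ 0)
    (hs : shaAn W = ((1 : ℕ) : ℚ))
    (A : WeierstrassCurve ℚ) (hA : A = ⟨0, 0, 0, 0, (-675)⟩)
    (hr : A.analyticRank = 0) (hm : shaAn A = ((1 : ℕ) : ℂ)) (htam : ¬ 5 ∣ A.tamagawaProduct)
    (S : Finset (HeightOneSpectrum (𝓞 ℚ))) (hS : ∀ v ∉ S, (((5 : ℕ) : ℕ) : 𝓞 ℚ) ∉ v.asIdeal ∧ A.HasGoodReductionAt v)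
    (hlocp : ∀ v ∈ S, (((5 : ℕ) : ℕ) : 𝓞 ℚ) ∈ v.asIdeal →
      ∀ x : A.geomPrimaryTorsion 5, 5 • x = 0 → (∀ d ∈ decomp v, d • x = x) → x = 0) :
    ∀ (V : WeierstrassCurve ℚ) [V.IsElliptic] [V.IsGloballyMinimal] [Fact (5 : ℕ).Prime],
      (∃ C : VariableChange ℚ, C • W.quadraticTwist (5) = V) →
      V.HasGoodReductionAtPrime 5 → V.frobeniusTrace 5 = 0 →
      (∀ {N : ℕ} [NeZero N] {f : CuspForm (Gamma0 N) 2}, IsNewformOf V f →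
        ∀ (ϖ : ℚ), (if Even (5 / 2) then (ϖ : ℝ) * V.realPeriodRat = plusPeriod f
            else (ϖ : ℝ) * V.imaginaryPeriodRat = minusPeriod f) →
        ∀ (Lη : IwasawaAlgebra 5), IsQuadraticBranchPlusLFunction f 5 ϖ Lη → HasUnitContent Lη) →
        QuadraticBranchPlusEtaMainConjectureAt V 5 := by
  refine EtaFineRoadRecords.etaMC_r0_159300l1_5_cmUnitSibling hPT hmod hGZK h22 h41 hKO h6273 hS28 W hW hLW hs A hA ?_ hr hm htam S hS hlocp
  subst hW; subst hA
  haveI := EtaFineRoadRecords.isElliptic_159300l1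
  haveI := EtaFineRoadRecords.isElliptic_A2700
  exact EtaModFiveCongruenceRecords.modPCongruent_159300l1_A2700 hF _ _ rfl rfl

set_option maxRecDepth 100000 in
/-- **`etaMC_r0_164700i1_5_cmUnitSibling_fisher`, the congruence from print** — the record
`EtaFineRoadRecords.etaMC_r0_164700i1_5_cmUnitSibling` (k8eta-c2 g7) with its displayed mod-`5` congruence `hcong : W[5] ≃ A[5]`
(row `164700i1` ~ CM unit sibling `A = [0, 0, 0, 0, -675]`) DISCHARGED:
`hcong := EtaModFiveCongruenceRecords.modPCongruent_164700i1_A2700 hF …` — the row is the point `(λ:μ) = (-90 : 1)` of the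
INDIRECT Hesse family of `A`, rescaled by `v = 1/5509980288000000` (kernel certificate), so the congruence now rests on the
NAMED PUBLISHED FACT `HesseFamilyFive.thm58_geomTorsionFive_of_dualHesseFamily` alone (Fisher). All other binders, the
conclusion and the honest framing are those of the original record VERBATIM (per-row instance; CONDITIONAL on the named facts in
hypothesis position; the anchor's `r_an = 0`, `#Ш_an = 1`, `5 ∤ Tam`, the local test at `5`, and the row's L-data stay
displayed; nothing booked; BSD for no pair). [cite: Fisher2013TwistsOfX5, Thm. 5.8] [cite: LimSujatha2018, §3 Prop. 3.2]
[cite: Kobayashi2003, §4 (p. 8)] [cite: Cremona1997, Table 1 (label 164700i1)] -/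
theorem etaMC_r0_164700i1_5_cmUnitSibling_fisher (hF : thm58_geomTorsionFive_of_dualHesseFamily)
    (hPT : poitouTate_selmerStructure_duality_real ℚ) (hmod : hasEntireLFunction_rat)
    (hGZK : rank_eq_analyticRank_of_analyticRank_le_one)
    (h22 : Kobayashi2003.thm22_etaSignedSelmerDual_finite_torsion)
    (h41 : Kobayashi2003.thm41_plusEtaCharIdeal_dvd)
    (hKO : KitajimaOtsuki2018.mainThm13_etaSignedSelmerDual_noFiniteSubmodule)
    (h6273 : Kobayashi2003.thm62_63_73_etaColemanPoitouTate) (hS28 : bsdTriple_of_hasCM_of_L_one_ne_zero)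
    (W : WeierstrassCurve ℚ) (hW : W = ⟨0, 0, 0, (-119963625), (-505734387375)⟩) (hLW : W.entireLFunction 1 ≠ 0)
    (hs : shaAn W = ((1 : ℕ) : ℚ))
    (A : WeierstrassCurve ℚ) (hA : A = ⟨0, 0, 0, 0, (-675)⟩)
    (hr : A.analyticRank = 0) (hm : shaAn A = ((1 : ℕ) : ℂ)) (htam : ¬ 5 ∣ A.tamagawaProduct)
    (S : Finset (HeightOneSpectrum (𝓞 ℚ))) (hS : ∀ v ∉ S, (((5 : ℕ) : ℕ) : 𝓞 ℚ) ∉ v.asIdeal ∧ A.HasGoodReductionAt v)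
    (hlocp : ∀ v ∈ S, (((5 : ℕ) : ℕ) : 𝓞 ℚ) ∈ v.asIdeal →
      ∀ x : A.geomPrimaryTorsion 5, 5 • x = 0 → (∀ d ∈ decomp v, d • x = x) → x = 0) :
    ∀ (V : WeierstrassCurve ℚ) [V.IsElliptic] [V.IsGloballyMinimal] [Fact (5 : ℕ).Prime],
      (∃ C : VariableChange ℚ, C • W.quadraticTwist (5) = V) →
      V.HasGoodReductionAtPrime 5 → V.frobeniusTrace 5 = 0 →
      (∀ {N : ℕ} [NeZero N] {f : CuspForm (Gamma0 N) 2}, IsNewformOf V f →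
        ∀ (ϖ : ℚ), (if Even (5 / 2) then (ϖ : ℝ) * V.realPeriodRat = plusPeriod f
            else (ϖ : ℝ) * V.imaginaryPeriodRat = minusPeriod f) →
        ∀ (Lη : IwasawaAlgebra 5), IsQuadraticBranchPlusLFunction f 5 ϖ Lη → HasUnitContent Lη) →
        QuadraticBranchPlusEtaMainConjectureAt V 5 := by
  refine EtaFineRoadRecords.etaMC_r0_164700i1_5_cmUnitSibling hPT hmod hGZK h22 h41 hKO h6273 hS28 W hW hLW hs A hA ?_ hr hm htam S hS hlocp
  subst hW; subst hA
  haveI := EtaFineRoadRecords.isElliptic_164700i1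
  haveI := EtaFineRoadRecords.isElliptic_A2700
  exact EtaModFiveCongruenceRecords.modPCongruent_164700i1_A2700 hF _ _ rfl rfl

set_option maxRecDepth 100000 in
/-- **`etaMC_r0_164700n1_5_cmUnitSibling_fisher`, the congruence from print** — the record
`EtaFineRoadRecords.etaMC_r0_164700n1_5_cmUnitSibling` (k8eta-c2 g7) with its displayed mod-`5` congruence `hcong : W[5] ≃ A[5]`
(row `164700n1` ~ CM unit sibling `A = [0, 0, 0, 0, -675]`) DISCHARGED:
`hcong := EtaModFiveCongruenceRecords.modPCongruent_164700n1_A2700 hF …` — the row is the point `(λ:μ) = (180 : 1)` of the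
DIRECT Hesse family of `A`, rescaled by `v = 1/37791360000` (kernel certificate), so the congruence now rests on the NAMED
PUBLISHED FACT `HesseFamilyFive.thm132_geomTorsionFive_of_hesseFamily` alone (Fisher). All other binders, the conclusion and the
honest framing are those of the original record VERBATIM (per-row instance; CONDITIONAL on the named facts in hypothesis
position; the anchor's `r_an = 0`, `#Ш_an = 1`, `5 ∤ Tam`, the local test at `5`, and the row's L-data stay displayed; nothing
booked; BSD for no pair). [cite: Fisher2012Hessian, Thm. 13.2 (i)] [cite: LimSujatha2018, §3 Prop. 3.2]
[cite: Kobayashi2003, §4 (p. 8)] [cite: Cremona1997, Table 1 (label 164700n1)] -/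
theorem etaMC_r0_164700n1_5_cmUnitSibling_fisher (hF : thm132_geomTorsionFive_of_hesseFamily)
    (hPT : poitouTate_selmerStructure_duality_real ℚ) (hmod : hasEntireLFunction_rat)
    (hGZK : rank_eq_analyticRank_of_analyticRank_le_one)
    (h22 : Kobayashi2003.thm22_etaSignedSelmerDual_finite_torsion)
    (h41 : Kobayashi2003.thm41_plusEtaCharIdeal_dvd)
    (hKO : KitajimaOtsuki2018.mainThm13_etaSignedSelmerDual_noFiniteSubmodule)
    (h6273 : Kobayashi2003.thm62_63_73_etaColemanPoitouTate) (hS28 : bsdTriple_of_hasCM_of_L_one_ne_zero)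
    (W : WeierstrassCurve ℚ) (hW : W = ⟨0, 0, 0, (-1079672625), 13654828459125⟩) (hLW : W.entireLFunction 1 ≠ 0)
    (hs : shaAn W = ((1 : ℕ) : ℚ))
    (A : WeierstrassCurve ℚ) (hA : A = ⟨0, 0, 0, 0, (-675)⟩)
    (hr : A.analyticRank = 0) (hm : shaAn A = ((1 : ℕ) : ℂ)) (htam : ¬ 5 ∣ A.tamagawaProduct)
    (S : Finset (HeightOneSpectrum (𝓞 ℚ))) (hS : ∀ v ∉ S, (((5 : ℕ) : ℕ) : 𝓞 ℚ) ∉ v.asIdeal ∧ A.HasGoodReductionAt v)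
    (hlocp : ∀ v ∈ S, (((5 : ℕ) : ℕ) : 𝓞 ℚ) ∈ v.asIdeal →
      ∀ x : A.geomPrimaryTorsion 5, 5 • x = 0 → (∀ d ∈ decomp v, d • x = x) → x = 0) :
    ∀ (V : WeierstrassCurve ℚ) [V.IsElliptic] [V.IsGloballyMinimal] [Fact (5 : ℕ).Prime],
      (∃ C : VariableChange ℚ, C • W.quadraticTwist (5) = V) →
      V.HasGoodReductionAtPrime 5 → V.frobeniusTrace 5 = 0 →
      (∀ {N : ℕ} [NeZero N] {f : CuspForm (Gamma0 N) 2}, IsNewformOf V f →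
        ∀ (ϖ : ℚ), (if Even (5 / 2) then (ϖ : ℝ) * V.realPeriodRat = plusPeriod f
            else (ϖ : ℝ) * V.imaginaryPeriodRat = minusPeriod f) →
        ∀ (Lη : IwasawaAlgebra 5), IsQuadraticBranchPlusLFunction f 5 ϖ Lη → HasUnitContent Lη) →
        QuadraticBranchPlusEtaMainConjectureAt V 5 := by
  refine EtaFineRoadRecords.etaMC_r0_164700n1_5_cmUnitSibling hPT hmod hGZK h22 h41 hKO h6273 hS28 W hW hLW hs A hA ?_ hr hm htam S hS hlocp
  subst hW; subst hA
  haveI := EtaFineRoadRecords.isElliptic_164700n1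
  haveI := EtaFineRoadRecords.isElliptic_A2700
  exact EtaModFiveCongruenceRecords.modPCongruent_164700n1_A2700 hF _ _ rfl rfl

set_option maxRecDepth 100000 in
/-- **`etaMC_r1_78300bd1_5_cmUnitSibling_fisher`, the congruence from print** — the record
`EtaFineRoadRecords.etaMC_r1_78300bd1_5_cmUnitSibling` (k8eta-c2 g7) with its displayed mod-`5` congruence `hcong : W[5] ≃ A[5]`
(row `78300bd1` ~ CM unit sibling `A = [0, 0, 0, 0, -675]`) DISCHARGED:
`hcong := EtaModFiveCongruenceRecords.modPCongruent_78300bd1_A2700 hF …` — the row is the point `(λ:μ) = (360 : 1)` of the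
DIRECT Hesse family of `A`, rescaled by `v = 1/2720977920000` (kernel certificate), so the congruence now rests on the NAMED
PUBLISHED FACT `HesseFamilyFive.thm132_geomTorsionFive_of_hesseFamily` alone (Fisher). All other binders, the conclusion and the
honest framing are those of the original record VERBATIM (per-row instance; CONDITIONAL on the named facts in hypothesis
position; the anchor's `r_an = 0`, `#Ш_an = 1`, `5 ∤ Tam`, the local test at `5`, and the row's L-data stay displayed; nothing
booked; BSD for no pair). [cite: Fisher2012Hessian, Thm. 13.2 (i)] [cite: LimSujatha2018, §3 Prop. 3.2]
[cite: Kobayashi2003, §4 (p. 8)] [cite: Cremona1997, Table 1 (label 78300bd1)] -/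
theorem etaMC_r1_78300bd1_5_cmUnitSibling_fisher (hF : thm132_geomTorsionFive_of_hesseFamily)
    (hmod : hasEntireLFunction_rat)
    (hGZK : rank_eq_analyticRank_of_analyticRank_le_one)
    (h22 : Kobayashi2003.thm22_etaSignedSelmerDual_finite_torsion)
    (h41 : Kobayashi2003.thm41_plusEtaCharIdeal_dvd)
    (h6273 : Kobayashi2003.thm62_63_73_etaColemanPoitouTate) (hS28 : bsdTriple_of_hasCM_of_L_one_ne_zero)
    (W : WeierstrassCurve ℚ) (hW : W = ⟨0, 0, 0, (-78375), (-5017250)⟩)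
    (A : WeierstrassCurve ℚ) (hA : A = ⟨0, 0, 0, 0, (-675)⟩)
    (hr : A.analyticRank = 0) (hm : shaAn A = ((1 : ℕ) : ℂ)) (htam : ¬ 5 ∣ A.tamagawaProduct)
    (S : Finset (HeightOneSpectrum (𝓞 ℚ))) (hS : ∀ v ∉ S, (((5 : ℕ) : ℕ) : 𝓞 ℚ) ∉ v.asIdeal ∧ A.HasGoodReductionAt v)
    (hlocp : ∀ v ∈ S, (((5 : ℕ) : ℕ) : 𝓞 ℚ) ∈ v.asIdeal →
      ∀ x : A.geomPrimaryTorsion 5, 5 • x = 0 → (∀ d ∈ decomp v, d • x = x) → x = 0) :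
    ∀ (V : WeierstrassCurve ℚ) [V.IsElliptic] [V.IsGloballyMinimal] [Fact (5 : ℕ).Prime],
      (∃ C : VariableChange ℚ, C • W.quadraticTwist (5) = V) →
      V.HasGoodReductionAtPrime 5 → V.frobeniusTrace 5 = 0 → W.analyticRank = 1 →
      (∀ {N : ℕ} [NeZero N] {f : CuspForm (Gamma0 N) 2}, IsNewformOf V f →
        ∀ (ϖ : ℚ), (if Even (5 / 2) then (ϖ : ℝ) * V.realPeriodRat = plusPeriod f
            else (ϖ : ℝ) * V.imaginaryPeriodRat = minusPeriod f) →
        ∀ (Lη : IwasawaAlgebra 5), IsQuadraticBranchPlusLFunction f 5 ϖ Lη →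
          Ideal.span {Lη} = Ideal.span {(PowerSeries.X : IwasawaAlgebra 5)}) →
        QuadraticBranchPlusEtaMainConjectureAt V 5 := by
  refine EtaFineRoadRecords.etaMC_r1_78300bd1_5_cmUnitSibling hmod hGZK h22 h41 h6273 hS28 W hW A hA ?_ hr hm htam S hS hlocp
  subst hW; subst hA
  haveI := EtaFineRoadRecords.isElliptic_78300bd1
  haveI := EtaFineRoadRecords.isElliptic_A2700
  exact EtaModFiveCongruenceRecords.modPCongruent_78300bd1_A2700 hF _ _ rfl rfl

set_option maxRecDepth 100000 in
/-- **`etaMC_r1_159300h1_5_cmUnitSibling_fisher`, the congruence from print** — the record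
`EtaFineRoadRecords.etaMC_r1_159300h1_5_cmUnitSibling` (k8eta-c2 g7) with its displayed mod-`5` congruence `hcong : W[5] ≃ A[5]`
(row `159300h1` ~ CM unit sibling `A = [0, 0, 0, 0, -675]`) DISCHARGED:
`hcong := EtaModFiveCongruenceRecords.modPCongruent_159300h1_A2700 hF …` — the row is the point `(λ:μ) = (90 : 1)` of the
INDIRECT Hesse family of `A`, rescaled by `v = 1/16529940864000000` (kernel certificate), so the congruence now rests on the
NAMED PUBLISHED FACT `HesseFamilyFive.thm58_geomTorsionFive_of_dualHesseFamily` alone (Fisher). All other binders, the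
conclusion and the honest framing are those of the original record VERBATIM (per-row instance; CONDITIONAL on the named facts in
hypothesis position; the anchor's `r_an = 0`, `#Ш_an = 1`, `5 ∤ Tam`, the local test at `5`, and the row's L-data stay
displayed; nothing booked; BSD for no pair). [cite: Fisher2013TwistsOfX5, Thm. 5.8] [cite: LimSujatha2018, §3 Prop. 3.2]
[cite: Kobayashi2003, §4 (p. 8)] [cite: Cremona1997, Table 1 (label 159300h1)] -/
theorem etaMC_r1_159300h1_5_cmUnitSibling_fisher (hF : thm58_geomTorsionFive_of_dualHesseFamily)
    (hmod : hasEntireLFunction_rat)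
    (hGZK : rank_eq_analyticRank_of_analyticRank_le_one)
    (h22 : Kobayashi2003.thm22_etaSignedSelmerDual_finite_torsion)
    (h41 : Kobayashi2003.thm41_plusEtaCharIdeal_dvd)
    (h6273 : Kobayashi2003.thm62_63_73_etaColemanPoitouTate) (hS28 : bsdTriple_of_hasCM_of_L_one_ne_zero)
    (W : WeierstrassCurve ℚ) (hW : W = ⟨0, 0, 0, (-1090125), (-344428875)⟩)
    (A : WeierstrassCurve ℚ) (hA : A = ⟨0, 0, 0, 0, (-675)⟩)
    (hr : A.analyticRank = 0) (hm : shaAn A = ((1 : ℕ) : ℂ)) (htam : ¬ 5 ∣ A.tamagawaProduct)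
    (S : Finset (HeightOneSpectrum (𝓞 ℚ))) (hS : ∀ v ∉ S, (((5 : ℕ) : ℕ) : 𝓞 ℚ) ∉ v.asIdeal ∧ A.HasGoodReductionAt v)
    (hlocp : ∀ v ∈ S, (((5 : ℕ) : ℕ) : 𝓞 ℚ) ∈ v.asIdeal →
      ∀ x : A.geomPrimaryTorsion 5, 5 • x = 0 → (∀ d ∈ decomp v, d • x = x) → x = 0) :
    ∀ (V : WeierstrassCurve ℚ) [V.IsElliptic] [V.IsGloballyMinimal] [Fact (5 : ℕ).Prime],
      (∃ C : VariableChange ℚ, C • W.quadraticTwist (5) = V) →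
      V.HasGoodReductionAtPrime 5 → V.frobeniusTrace 5 = 0 → W.analyticRank = 1 →
      (∀ {N : ℕ} [NeZero N] {f : CuspForm (Gamma0 N) 2}, IsNewformOf V f →
        ∀ (ϖ : ℚ), (if Even (5 / 2) then (ϖ : ℝ) * V.realPeriodRat = plusPeriod f
            else (ϖ : ℝ) * V.imaginaryPeriodRat = minusPeriod f) →
        ∀ (Lη : IwasawaAlgebra 5), IsQuadraticBranchPlusLFunction f 5 ϖ Lη →
          Ideal.span {Lη} = Ideal.span {(PowerSeries.X : IwasawaAlgebra 5)}) →
        QuadraticBranchPlusEtaMainConjectureAt V 5 := by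
  refine EtaFineRoadRecords.etaMC_r1_159300h1_5_cmUnitSibling hmod hGZK h22 h41 h6273 hS28 W hW A hA ?_ hr hm htam S hS hlocp
  subst hW; subst hA
  haveI := EtaFineRoadRecords.isElliptic_159300h1
  haveI := EtaFineRoadRecords.isElliptic_A2700
  exact EtaModFiveCongruenceRecords.modPCongruent_159300h1_A2700 hF _ _ rfl rfl

end EtaFineRoadRecordsFisher

end Summit.BirchSwinnertonDyer.BirchSwinnertonDyer.Theorems

end
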